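/-
Copyright: cell pub-balaban-gaps (YM BLITZ Y1, track G1), seat g1-p2 GEN 11 (unit `pub-balaban-gaps-g1-p2`).  Row (D4) NODE O, MODEL level:
the PRESENTATION and the MULTIPLIER LETTERS of `D4WalkBlockFormCoercive` for 59b–66's one-scale covariant operator on the fine torus —
63's `covOp = A₀ − (V_W + V_av)` with 59b's structured `V_W = covCoeff₀ + Σ_ι covCoeff ι·covDop ι`, read as `A₀ + V₀ + Σ_ι B_ι·D_ι`
(`V₀ = −covCoeff₀ − V_av`, `B_ι = −covCoeff ι`, `D_ι = covDop ι`); the multipliers are SITE-LOCAL fibre coefficients (`fibDiag`), hence reduce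
every fibre-saturated `□̃`, and for a FIBRE-CONSTANT weight their conjugated row ∕ column sums ON `□̃` are the plain fibre row ∕ column sums —
so the (3.37)-type windows `rows, cols of W^±_μ(u,x) ≤ ηβ`, `of Σ_μ(W⁺_μ + W⁻_μ)(u,x) ≤ η²β₀` give k-FREE letters `β`, `β₀` after the `η⁻¹`,
`η⁻²` of the coefficients.  HONEST FRAMING: model-level bookkeeping ([folklore]); the windows and the averaging term's Schur budget are
hypothesis data; Bałaban's `Δ^{(k)}(𝐔)` NOT constructed; (D4) instance 0∕1; NOT BetaPertH, NOT continuum, NOT Clay.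
-/
import Summits.QuantumFields.BalabanUV.Gaps.D4WalkBlockCovariantPropagator
import Summits.QuantumFields.BalabanUV.Gaps.D4WalkBlockLocalInverse

/-!
# `Gaps.D4WalkBlockFormShiftTorus` — the presentation `covOp = A₀ + V₀ + Σ_ι B_ι·covDop ι` of the one-scale covariant operator and the
# conjugated letters of its site-local multipliers on a fibre-saturated cube (cell pub-balaban-gaps, seat g1-p2 gen 11)

HONEST DEPENDENCY (cell pub-balaban, verbatim): continuum YM on T⁴ ⇐ BetaPertH ∧ nine spine estimates (0/9 proved); BetaPertH ⇐ (D1) ∧ (D4) ∧ CAP+tail.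

[B9] (3.52)–(3.54) pp. 400–401: `V′(A)` = multipliers of size `η⁻¹·(e^{iηA} − 1) = O(|A|)` next to covariant differences, plus zeroth-order
terms; (3.37) p. 396: the window on `A`.  ON 59b ∕ 63's OBJECTS ([folklore] throughout):
* §1 **`covOp_presented`**: `covOp u = A₀ + (−covCoeff₀ u − V_av u) + Σ_ι (−covCoeff ι u)·covDop ι`, `A₀ = m²·1 + flatLap + α•Pf`
  (63's `flatOp_sub_perturb` BY NAME);
* §2 site-local multipliers and the cube: `fibDiag_reduces` (`fibDiag w` reduces every fibre-saturated `S`), `cRow_add_le` ∕ `cCol_add_le` ∕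
  `cRow_smul` ∕ `cCol_smul` ∕ `cRow_neg` ∕ `cCol_neg`, **`cRow_compress_fibDiag_le`** ∕ **`cCol_compress_fibDiag_le`** (for a fibre-constant weight the conjugated sums ON `S` are bounded by
  the plain fibre row ∕ column sums of `w(x)`);
* §3 the letters: **`letters_covCoeff`** (`cRow, cCol (compress (−covCoeff ι u) S) ≤ β` from `rows, cols of W^±_μ(u,x) ≤ ηβ`),
  **`schur_covCoeff₀`** (`cRow, cCol (compress (−covCoeff₀ u) S) ≤ β₀` from `rows, cols of Σ_μ(W⁺_μ + W⁻_μ)(u,x) ≤ η²β₀`),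
  `schur_V₀` (adding the averaging term's conjugated Schur budget `γ_r, γ_c` on `S`).
WHAT IT IS NOT.  The windows themselves (66's `bond_letters` ∕ `deriv_letters` from (3.37) on `X`), the averaging budget (64's contour letters) and the
assembly with 109 ∕ 111 ∕ 112 are NOT here; (D4) instance 0∕1; words of row (D4) UNCHANGED (`ExistsUniformAcrossSmall 𝓣_Bałaban α Rσ₀ θ₀` +
`TermDomination`, OBJECT level).

References (method only): T. Bałaban, Comm. Math. Phys. **99** (1985) 389–434 [B9], (3.37) p. 396, (3.50)–(3.54) pp. 400–401, Cor. 3.6 p. 408.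
-/

noncomputable section

namespace Summit.QuantumFields.BalabanUV.Gaps.D4WalkBlockFormShiftTorus

open Metric Set Finset Complex Matrix
open scoped BigOperators Matrix ComplexConjugate
open Literature.MathematicalPhysics.QuantumFieldTheory.Balaban1983to89
open Summit.QuantumFields.BalabanUV.Beta.UnitLatticeLocalInverse (compress)
open Summit.QuantumFields.BalabanUV.Gaps.D4WalkBlockCovariantGeometry (fibDiag)
open Summit.QuantumFields.BalabanUV.Gaps.D4WalkBlockCovariantShift (covDop covCoeff covCoeff₀ covShift flatLap covCoeff_inl covCoeff_inr
  covCoeff₀_apply)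
open Summit.QuantumFields.BalabanUV.Gaps.D4WalkBlockCovariantPropagator (Pf Vav covOp flatOp_sub_perturb)
open Summit.QuantumFields.BalabanUV.Gaps.D4WalkBlockLocalInverse (cRow cCol)

variable {P : Params} {F : Type} [Fintype F] [DecidableEq F]
variable {E : Type*} [NormedAddCommGroup E] [NormedSpace ℂ E]
variable {Wp Wm : Fin P.d → E → Site P 0 → Matrix F F ℂ} {PU : E → Matrix (Site P 0 × F) (Site P 0 × F) ℂ} {a msq : ℝ}

/-! ## §1. The presentation -/

omit [NormedAddCommGroup E] [NormedSpace ℂ E] in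
/-- **`covOp = A₀ + V₀ + Σ_ι B_ι·D_ι`** with `A₀ = m²·1 + flatLap + α•Pf`, `V₀(u) = −covCoeff₀ u − V_av u`, `B_ι(u) = −covCoeff ι u`, `D_ι = covDop ι`.
[cite: Balaban1985BackgroundPropagators, (3.50)–(3.54) pp.400–401] -/
theorem covOp_presented (u : E) :
    covOp P F Wp Wm PU a msq u
      = ((msq : ℂ) • (1 : Matrix (Site P 0 × F) (Site P 0 × F) ℂ) + flatLap P F + (B1RG242Torus.α P a P.K : ℂ) • Pf P F)
        + (-covCoeff₀ P F Wp Wm u + -Vav P F PU a u) + ∑ ι, (-covCoeff P F Wp Wm ι u) * covDop P F ι := by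
  rw [← flatOp_sub_perturb, covShift]
  simp only [Matrix.neg_mul, Finset.sum_neg_distrib]
  abel

/-! ## §2. Site-local multipliers on a fibre-saturated cube -/

omit [Fintype F] [DecidableEq F] in
/-- a site-local fibre coefficient reduces every fibre-saturated `S`. -/
theorem fibDiag_reduces (w : Site P 0 → Matrix F F ℂ) {S : Finset (Site P 0 × F)} (hS : ∀ p ∈ S, ∀ b : F, (p.1, b) ∈ S)
    (p q : Site P 0 × F) (h : fibDiag P F w p q ≠ 0) : p ∈ S ↔ q ∈ S := by
  have hx : p.1 = q.1 := by
    unfold fibDiag at h; rw [Matrix.of_apply] at h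
    by_contra hne; exact h (if_neg hne)
  constructor
  · intro hp; have := hS p hp q.2; rwa [hx] at this
  · intro hq; have := hS q hq p.2; rwa [← hx] at this

section SchurAlgebra
variable {ι : Type*} [Fintype ι]

/-- `cRow (c•R) = ‖c‖·cRow R`. -/
theorem cRow_smul (c : ℂ) (R : Matrix ι ι ℂ) (κ : ℝ) (ρ : ι → ℝ) (e : ι) : cRow (c • R) κ ρ e = ‖c‖ * cRow R κ ρ e := by
  unfold cRow; rw [Finset.mul_sum]
  exact Finset.sum_congr rfl fun e' _ => by rw [Matrix.smul_apply, smul_eq_mul, norm_mul, mul_assoc]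

/-- `cCol (c•R) = ‖c‖·cCol R`. -/
theorem cCol_smul (c : ℂ) (R : Matrix ι ι ℂ) (κ : ℝ) (ρ : ι → ℝ) (e' : ι) : cCol (c • R) κ ρ e' = ‖c‖ * cCol R κ ρ e' := by
  unfold cCol; rw [Finset.mul_sum]
  exact Finset.sum_congr rfl fun e _ => by rw [Matrix.smul_apply, smul_eq_mul, norm_mul, mul_assoc]

/-- `cRow (A + B) ≤ cRow A + cRow B`. -/
theorem cRow_add_le (A B : Matrix ι ι ℂ) (κ : ℝ) (ρ : ι → ℝ) (e : ι) : cRow (A + B) κ ρ e ≤ cRow A κ ρ e + cRow B κ ρ e := by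
  unfold cRow; rw [← Finset.sum_add_distrib]
  exact Finset.sum_le_sum fun e' _ => by
    rw [Matrix.add_apply, ← add_mul]; exact mul_le_mul_of_nonneg_right (norm_add_le _ _) (Real.exp_nonneg _)

/-- `cCol (A + B) ≤ cCol A + cCol B`. -/
theorem cCol_add_le (A B : Matrix ι ι ℂ) (κ : ℝ) (ρ : ι → ℝ) (e' : ι) : cCol (A + B) κ ρ e' ≤ cCol A κ ρ e' + cCol B κ ρ e' := by
  unfold cCol; rw [← Finset.sum_add_distrib]
  exact Finset.sum_le_sum fun e _ => by
    rw [Matrix.add_apply, ← add_mul]; exact mul_le_mul_of_nonneg_right (norm_add_le _ _) (Real.exp_nonneg _)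

/-- `cRow (−R) = cRow R`. -/
theorem cRow_neg (R : Matrix ι ι ℂ) (κ : ℝ) (ρ : ι → ℝ) (e : ι) : cRow (-R) κ ρ e = cRow R κ ρ e := by
  unfold cRow; exact Finset.sum_congr rfl fun e' _ => by rw [Matrix.neg_apply, norm_neg]

/-- `cCol (−R) = cCol R`. -/
theorem cCol_neg (R : Matrix ι ι ℂ) (κ : ℝ) (ρ : ι → ℝ) (e' : ι) : cCol (-R) κ ρ e' = cCol R κ ρ e' := by
  unfold cCol; exact Finset.sum_congr rfl fun e _ => by rw [Matrix.neg_apply, norm_neg]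

end SchurAlgebra

variable (ρ : Site P 0 × F → ℝ) (hρF : ∀ (x : Site P 0) (b b' : F), ρ (x, b) = ρ (x, b'))
include hρF

omit [DecidableEq F] hρF in
/-- a fibre sum over the part of `S` above one site is at most the full fibre sum. -/
theorem sum_subtype_site_le (S : Finset (Site P 0 × F)) (x : Site P 0) (g : F → ℝ) (hg : ∀ b, 0 ≤ g b) :
    ∑ e' : S, (if (e' : Site P 0 × F).1 = x then g (e' : Site P 0 × F).2 else 0) ≤ ∑ b, g b := by
  calc ∑ e' : S, (if (e' : Site P 0 × F).1 = x then g (e' : Site P 0 × F).2 else 0)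
      = ∑ q ∈ S, (if q.1 = x then g q.2 else 0) := Finset.sum_coe_sort S (fun q : Site P 0 × F => if q.1 = x then g q.2 else 0)
    _ ≤ ∑ q : Site P 0 × F, (if q.1 = x then g q.2 else 0) :=
        Finset.sum_le_sum_of_subset_of_nonneg (Finset.subset_univ S) fun q _ _ => by split_ifs <;> simp [hg]
    _ = ∑ b, g b := by
        rw [Fintype.sum_prod_type, Finset.sum_eq_single x (fun x' _ hx' => by simp [hx']) (fun h => absurd (Finset.mem_univ x) h)]
        simp

omit [DecidableEq F] in
/-- **conjugated ROW sums of a compressed site-local multiplier** (fibre-constant weight): `cRow (compress (fibDiag w) S) κ ρ (x,a) ≤ Σ_b ‖w(x)_{ab}‖`. -/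
theorem cRow_compress_fibDiag_le (w : Site P 0 → Matrix F F ℂ) (S : Finset (Site P 0 × F)) (κ : ℝ) (e : S) :
    cRow (compress (fibDiag P F w) S) κ (fun e : S => ρ e) e ≤ ∑ b, ‖w (e : Site P 0 × F).1 (e : Site P 0 × F).2 b‖ := by
  refine le_trans (le_of_eq (Finset.sum_congr rfl fun e' _ => ?_))
    (sum_subtype_site_le S (e : Site P 0 × F).1 (fun b => ‖w (e : Site P 0 × F).1 (e : Site P 0 × F).2 b‖) fun b => norm_nonneg _)
  simp only [compress, Matrix.submatrix_apply, fibDiag, Matrix.of_apply]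
  by_cases h : (e : Site P 0 × F).1 = (e' : Site P 0 × F).1
  · rw [if_pos h, if_pos h.symm, show ρ e = ρ e' by
      rw [show ((e : Site P 0 × F)) = ((e : Site P 0 × F).1, (e : Site P 0 × F).2) from rfl,
        show ((e' : Site P 0 × F)) = ((e' : Site P 0 × F).1, (e' : Site P 0 × F).2) from rfl, h]; exact hρF _ _ _,
      sub_self, mul_zero, Real.exp_zero, mul_one]
  · rw [if_neg h, if_neg (fun h' => h h'.symm), norm_zero, zero_mul]

omit [DecidableEq F] in
/-- **conjugated COLUMN sums of a compressed site-local multiplier** (fibre-constant weight): `cCol (compress (fibDiag w) S) κ ρ (x,b) ≤ Σ_a ‖w(x)_{ab}‖`. -/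
theorem cCol_compress_fibDiag_le (w : Site P 0 → Matrix F F ℂ) (S : Finset (Site P 0 × F)) (κ : ℝ) (e' : S) :
    cCol (compress (fibDiag P F w) S) κ (fun e : S => ρ e) e' ≤ ∑ b, ‖w (e' : Site P 0 × F).1 b (e' : Site P 0 × F).2‖ := by
  refine le_trans (le_of_eq (Finset.sum_congr rfl fun e _ => ?_))
    (sum_subtype_site_le S (e' : Site P 0 × F).1 (fun b => ‖w (e' : Site P 0 × F).1 b (e' : Site P 0 × F).2‖) fun b => norm_nonneg _)
  simp only [compress, Matrix.submatrix_apply, fibDiag, Matrix.of_apply]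
  by_cases h : (e : Site P 0 × F).1 = (e' : Site P 0 × F).1
  · rw [if_pos h, if_pos h, h, show ρ e = ρ e' by
      rw [show ((e : Site P 0 × F)) = ((e : Site P 0 × F).1, (e : Site P 0 × F).2) from rfl,
        show ((e' : Site P 0 × F)) = ((e' : Site P 0 × F).1, (e' : Site P 0 × F).2) from rfl, h]; exact hρF _ _ _,
      sub_self, mul_zero, Real.exp_zero, mul_one]
  · rw [if_neg h, if_neg (fun h' => h h'), norm_zero, zero_mul]

/-! ## §3. The letters of the presentation from the windows -/

variable {R β β₀ γr γc : ℝ} (S : Finset (Site P 0 × F))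

omit [DecidableEq F] [NormedSpace ℂ E] in
/-- **FIRST-ORDER LETTERS**: rows and columns of `W^±_μ(u,x)` at most `ηβ` on the ball ⟹ the conjugated row and column sums ON `S` of every
multiplier `−covCoeff ι u` (`= ∓η⁻¹W^±_μ` site-locally) are at most `β` — the `η⁻¹` is gone. [cite: Balaban1985BackgroundPropagators, (3.37) p.396, (3.52) p.400] -/
theorem letters_covCoeff
    (hWp : ∀ μ, ∀ u ∈ ball (0 : E) R, ∀ x a, ∑ b, ‖Wp μ u x a b‖ ≤ P.eps * β ∧ ∑ b, ‖Wp μ u x b a‖ ≤ P.eps * β)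
    (hWm : ∀ μ, ∀ u ∈ ball (0 : E) R, ∀ x a, ∑ b, ‖Wm μ u x a b‖ ≤ P.eps * β ∧ ∑ b, ‖Wm μ u x b a‖ ≤ P.eps * β) :
    ∀ u ∈ ball (0 : E) R, ∀ (ι : Fin P.d ⊕ Fin P.d) (κ : ℝ) (e : S),
      cRow (compress (-covCoeff P F Wp Wm ι u) S) κ (fun e : S => ρ e) e ≤ β ∧ cCol (compress (-covCoeff P F Wp Wm ι u) S) κ (fun e : S => ρ e) e ≤ β := by
  intro u hu ι κ e
  have hε : 0 < P.eps := P.eps_pos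
  have hnorm : ‖(P.eps⁻¹ : ℂ)‖ = P.eps⁻¹ := by rw [← Complex.ofReal_inv, Complex.norm_real, Real.norm_eq_abs, abs_of_pos (inv_pos.mpr hε)]
  have hnorm' : ‖(-(P.eps⁻¹ : ℂ))‖ = P.eps⁻¹ := by rw [norm_neg, hnorm]
  have key : ∀ (c : ℂ) (w : Site P 0 → Matrix F F ℂ), ‖c‖ = P.eps⁻¹ →
      (∀ x a, ∑ b, ‖w x a b‖ ≤ P.eps * β ∧ ∑ b, ‖w x b a‖ ≤ P.eps * β) →
      cRow (compress (-fibDiag P F fun x => c • w x) S) κ (fun e : S => ρ e) e ≤ β ∧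
        cCol (compress (-fibDiag P F fun x => c • w x) S) κ (fun e : S => ρ e) e ≤ β := by
    intro c w hc hw
    have hfd : (fibDiag P F fun x => c • w x) = c • fibDiag P F w := D4WalkBlockCovariantGeometry.fibDiag_smul c w
    rw [hfd, show compress (-(c • fibDiag P F w)) S = -(c • compress (fibDiag P F w) S) from rfl, cRow_neg, cCol_neg, cRow_smul, cCol_smul, hc]
    constructor
    · calc P.eps⁻¹ * cRow (compress (fibDiag P F w) S) κ (fun e : S => ρ e) e ≤ P.eps⁻¹ * (P.eps * β) :=
            mul_le_mul_of_nonneg_left ((cRow_compress_fibDiag_le ρ hρF w S κ e).trans (hw _ _).1) (inv_nonneg.mpr hε.le)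
        _ = β := by rw [← mul_assoc, inv_mul_cancel₀ hε.ne', one_mul]
    · calc P.eps⁻¹ * cCol (compress (fibDiag P F w) S) κ (fun e : S => ρ e) e ≤ P.eps⁻¹ * (P.eps * β) :=
            mul_le_mul_of_nonneg_left ((cCol_compress_fibDiag_le ρ hρF w S κ e).trans (hw _ _).2) (inv_nonneg.mpr hε.le)
        _ = β := by rw [← mul_assoc, inv_mul_cancel₀ hε.ne', one_mul]
  rcases ι with μ | μ
  · rw [covCoeff_inl]; exact key _ _ hnorm (hWp μ u hu)
  · rw [covCoeff_inr]; exact key _ _ hnorm' (hWm μ u hu)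

omit [DecidableEq F] [NormedSpace ℂ E] in
/-- **ZEROTH-ORDER LETTER**: rows and columns of the divergence `Σ_μ(W⁺_μ + W⁻_μ)(u,x)` at most `η²β₀` ⟹ conjugated row and column sums ON `S` of
`−covCoeff₀ u` at most `β₀`. [cite: Balaban1985BackgroundPropagators, (3.37) p.396, (3.52)–(3.54) pp.400–401] -/
theorem schur_covCoeff₀
    (hW0 : ∀ u ∈ ball (0 : E) R, ∀ x a, ∑ b, ‖(∑ μ, (Wp μ u x + Wm μ u x)) a b‖ ≤ P.eps ^ 2 * β₀ ∧
      ∑ b, ‖(∑ μ, (Wp μ u x + Wm μ u x)) b a‖ ≤ P.eps ^ 2 * β₀) :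
    ∀ u ∈ ball (0 : E) R, ∀ (κ : ℝ) (e : S),
      cRow (compress (-covCoeff₀ P F Wp Wm u) S) κ (fun e : S => ρ e) e ≤ β₀ ∧ cCol (compress (-covCoeff₀ P F Wp Wm u) S) κ (fun e : S => ρ e) e ≤ β₀ := by
  intro u hu κ e
  have hε : 0 < P.eps := P.eps_pos
  have hc : ‖((P.eps⁻¹ : ℂ)) ^ 2‖ = P.eps⁻¹ ^ 2 := by
    rw [norm_pow, ← Complex.ofReal_inv, Complex.norm_real, Real.norm_eq_abs, abs_of_pos (inv_pos.mpr hε)]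
  have hfd : (fibDiag P F fun x => ((P.eps⁻¹ : ℂ) ^ 2) • ∑ μ, (Wp μ u x + Wm μ u x)) = ((P.eps⁻¹ : ℂ) ^ 2) • fibDiag P F fun x => ∑ μ, (Wp μ u x + Wm μ u x) :=
    D4WalkBlockCovariantGeometry.fibDiag_smul _ _
  have hc2 : compress (-(((P.eps⁻¹ : ℂ) ^ 2) • fibDiag P F fun x => ∑ μ, (Wp μ u x + Wm μ u x))) S
      = -(((P.eps⁻¹ : ℂ) ^ 2) • compress (fibDiag P F fun x => ∑ μ, (Wp μ u x + Wm μ u x)) S) := rfl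
  rw [covCoeff₀_apply, hfd, hc2, cRow_neg, cCol_neg, cRow_smul, cCol_smul, hc]
  have hε2 : P.eps⁻¹ ^ 2 * (P.eps ^ 2 * β₀) = β₀ := by rw [← mul_assoc, ← mul_pow, inv_mul_cancel₀ hε.ne', one_pow, one_mul]
  constructor
  · calc P.eps⁻¹ ^ 2 * cRow (compress (fibDiag P F fun x => ∑ μ, (Wp μ u x + Wm μ u x)) S) κ (fun e : S => ρ e) e
        ≤ P.eps⁻¹ ^ 2 * (P.eps ^ 2 * β₀) :=
          mul_le_mul_of_nonneg_left ((cRow_compress_fibDiag_le ρ hρF _ S κ e).trans (hW0 u hu _ _).1) (sq_nonneg _)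
      _ = β₀ := hε2
  · calc P.eps⁻¹ ^ 2 * cCol (compress (fibDiag P F fun x => ∑ μ, (Wp μ u x + Wm μ u x)) S) κ (fun e : S => ρ e) e
        ≤ P.eps⁻¹ ^ 2 * (P.eps ^ 2 * β₀) :=
          mul_le_mul_of_nonneg_left ((cCol_compress_fibDiag_le ρ hρF _ S κ e).trans (hW0 u hu _ _).2) (sq_nonneg _)
      _ = β₀ := hε2

omit [NormedSpace ℂ E] in
/-- **THE ZEROTH-ORDER SCHUR BUDGET** of `V₀(u) = −covCoeff₀ u − V_av u` ON `S`: `cRow ≤ β₀ + αγ_r`, `cCol ≤ β₀ + αγ_c`, the averaging term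
`V_av u = α(Pf − PU u)` entering through the conjugated Schur sums `γ_r, γ_c` of `compress (PU u − Pf) S` (64's contour letters times the
weight's oscillation on a block; hypothesis data here). [cite: Balaban1985BackgroundPropagators, (3.54) p.401, (3.8) p.392] -/
theorem schur_V₀ (hα : 0 ≤ B1RG242Torus.α P a P.K)
    (hW0 : ∀ u ∈ ball (0 : E) R, ∀ x a, ∑ b, ‖(∑ μ, (Wp μ u x + Wm μ u x)) a b‖ ≤ P.eps ^ 2 * β₀ ∧
      ∑ b, ‖(∑ μ, (Wp μ u x + Wm μ u x)) b a‖ ≤ P.eps ^ 2 * β₀) (κ : ℝ)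
    (hAr : ∀ u ∈ ball (0 : E) R, ∀ e : S, cRow (compress (PU u - Pf P F) S) κ (fun e : S => ρ e) e ≤ γr)
    (hAc : ∀ u ∈ ball (0 : E) R, ∀ e : S, cCol (compress (PU u - Pf P F) S) κ (fun e : S => ρ e) e ≤ γc) :
    ∀ u ∈ ball (0 : E) R, ∀ e : S,
      cRow (compress (-covCoeff₀ P F Wp Wm u + -Vav P F PU a u) S) κ (fun e : S => ρ e) e ≤ β₀ + B1RG242Torus.α P a P.K * γr ∧
      cCol (compress (-covCoeff₀ P F Wp Wm u + -Vav P F PU a u) S) κ (fun e : S => ρ e) e ≤ β₀ + B1RG242Torus.α P a P.K * γc := by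
  intro u hu e
  have h0 := schur_covCoeff₀ ρ hρF S hW0 u hu κ e
  have hav : -Vav P F PU a u = (B1RG242Torus.α P a P.K : ℂ) • (PU u - Pf P F) := by rw [Vav, ← smul_neg, neg_sub]
  have hn : ‖(B1RG242Torus.α P a P.K : ℂ)‖ = B1RG242Torus.α P a P.K := by rw [Complex.norm_real, Real.norm_eq_abs, abs_of_nonneg hα]
  have hsplit : compress (-covCoeff₀ P F Wp Wm u + -Vav P F PU a u) S
      = compress (-covCoeff₀ P F Wp Wm u) S + (B1RG242Torus.α P a P.K : ℂ) • compress (PU u - Pf P F) S := by rw [hav]; rfl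
  rw [hsplit]
  constructor
  · refine (cRow_add_le _ _ κ _ e).trans (add_le_add h0.1 ?_)
    rw [cRow_smul, hn]
    exact mul_le_mul_of_nonneg_left (hAr u hu e) hα
  · refine (cCol_add_le _ _ κ _ e).trans (add_le_add h0.2 ?_)
    rw [cCol_smul, hn]
    exact mul_le_mul_of_nonneg_left (hAc u hu e) hα

end Summit.QuantumFields.BalabanUV.Gaps.D4WalkBlockFormShiftTorus

end
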